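import Mathlib
import Summits.PneNP.PneNP.Theorems.ConvexRankGatesConvexGateBlindCatchTwo

/-!
# PneNP / ConvexRankGates — `ConvexGateBlind`: conditional expectations of the bichromatic mass are non-negative

Helpers (`--supports stmt-PneNP-10680`), COLUMN-SPACE line (prover seat 2, session 16): the probabilistic reading of the
realisation lemma `…CondPositivity.negMass_hub_le`.

THEOREM (`sum_extensions_bichMass_nonneg`, matrix form; `conditional_bichMass_nonneg`, stub, edge form). Let `w` be a
`k`-clique-non-negative edge weighting of `K_m` (`4 ≤ k`), `2 ≤ q`, and let `H` be a vertex set with `k ≤ #Hᶜ` and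
`(k−2)·#H/(#Hᶜ−1) ≤ 1/2`. Then for EVERY colouring `c₀`, the total bichromatic `w`-mass over all colourings
`c : Fin m → Fin q` that agree with `c₀` on `H` is non-negative:

  `∑_{c : c|_H = c₀|_H} ∑_{e bichromatic in c} w(e) ≥ 0`,   i.e.   `E[ w(bich_c) | c|_H ] ≥ 0` for every partial colouring of `H`.

(Re-randomising one free coordinate — `…MonoMoment.sum_eq_sum_sum_update_div` — shows that a pair with an endpoint outside `H`
is bichromatic in exactly a `(q−1)/q` fraction of the extensions, so the sum is `#ext · (bich_H(c₀) + (1−1/q)·mass_out)`,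
and `bich_H(c₀) ≥ −neg_H ≥ −½·mass_out` by the realisation lemma.) Sharp up to the constant in `#H`: for `#H > m/(k−1)` the
planted weighting on a monochromatic `H` has negative conditional expectation (session 4; LP check j021554 of the memo). [new]
-/

set_option linter.dupNamespace false

namespace Summit.PneNP.PneNP.Theorems

open Finset Real Literature.Computability.Complexity
open Summit.PneNP.PneNP.Cruxes.ConvexGateBlind.StrictRankConicCover (Edge)

noncomputable section

variable {m q : ℕ}

/-! ## Counting bichromatic pairs over the extensions of a partial colouring -/

/-- Over the colourings agreeing with `c₀` on `H`, a pair `(a, b)` with `a ∉ H`, `a ≠ b` is bichromatic in a `(q−1)/q`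
fraction: `∑_{c ext} 𝟙[c a ≠ c b]·t = ((q−1)/q) · #ext · t`. [folklore] -/
theorem sum_extensions_ite_ne (hq : 0 < q) (H : Finset (Fin m)) (c₀ : Fin m → Fin q) {a b : Fin m} (ha : a ∉ H)
    (hab : a ≠ b) (t : ℝ) :
    ∑ c ∈ (Finset.univ : Finset (Fin m → Fin q)).filter (fun c => ∀ x ∈ H, c x = c₀ x),
        (if c a = c b then 0 else t) =
      (((q : ℝ) - 1) / q) *
        ((((Finset.univ : Finset (Fin m → Fin q)).filter (fun c => ∀ x ∈ H, c x = c₀ x)).card : ℝ) * t) := by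
  classical
  have hq' : (q : ℝ) ≠ 0 := by exact_mod_cast hq.ne'
  -- agreement with `c₀` on `H` is invariant under recolouring `a ∉ H`
  have hupd : ∀ (c : Fin m → Fin q) (i : Fin q), (∀ x ∈ H, Function.update c a i x = c₀ x) ↔ ∀ x ∈ H, c x = c₀ x := by
    intro c i
    constructor
    · intro h x hx
      have hxa : x ≠ a := fun h' => ha (h' ▸ hx)
      have := h x hx
      rwa [Function.update_of_ne hxa] at this
    · intro h x hx
      have hxa : x ≠ a := fun h' => ha (h' ▸ hx)
      rw [Function.update_of_ne hxa]
      exact h x hx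
  rw [Finset.sum_filter, sum_eq_sum_sum_update_div hq _ a]
  -- after re-randomising `c a`, the inner sum is `(q - 1)·t` on the extensions and `0` elsewhere
  have hinner : ∀ c : Fin m → Fin q, ∑ i : Fin q,
      (if (∀ x ∈ H, Function.update c a i x = c₀ x) then
        (if Function.update c a i a = Function.update c a i b then (0 : ℝ) else t) else 0) =
      if (∀ x ∈ H, c x = c₀ x) then ((q : ℝ) - 1) * t else 0 := by
    intro c
    by_cases hc : ∀ x ∈ H, c x = c₀ x
    · rw [if_pos hc]
      have : ∀ i : Fin q, (if (∀ x ∈ H, Function.update c a i x = c₀ x) then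
          (if Function.update c a i a = Function.update c a i b then (0 : ℝ) else t) else 0) =
          if i = c b then 0 else t := by
        intro i
        rw [if_pos ((hupd c i).2 hc), Function.update_self, Function.update_of_ne (Ne.symm hab)]
      rw [Finset.sum_congr rfl (fun i _ => this i)]
      rw [Finset.sum_ite, Finset.sum_const_zero, zero_add, Finset.sum_const, nsmul_eq_mul]
      have hcard : ((Finset.univ : Finset (Fin q)).filter (fun i => ¬ i = c b)).card = q - 1 := by
        rw [Finset.filter_ne', Finset.card_erase_of_mem (Finset.mem_univ _), Finset.card_univ, Fintype.card_fin]
      rw [hcard, Nat.cast_sub (by omega), Nat.cast_one]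
    · rw [if_neg hc]
      refine Finset.sum_eq_zero fun i _ => ?_
      rw [if_neg (fun h => hc ((hupd c i).1 h))]
  rw [Finset.sum_congr rfl (fun c _ => hinner c), ← Finset.sum_filter, Finset.sum_const, nsmul_eq_mul]
  field_simp

/-- Over the extensions of `c₀|_H`, a pair inside `H` is bichromatic iff it is so in `c₀`. [folklore] -/
theorem sum_extensions_ite_mem (H : Finset (Fin m)) (c₀ : Fin m → Fin q) {a b : Fin m} (ha : a ∈ H) (hb : b ∈ H)
    (t : ℝ) :
    ∑ c ∈ (Finset.univ : Finset (Fin m → Fin q)).filter (fun c => ∀ x ∈ H, c x = c₀ x),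
        (if c a = c b then 0 else t) =
      ((((Finset.univ : Finset (Fin m → Fin q)).filter (fun c => ∀ x ∈ H, c x = c₀ x)).card : ℝ) *
        (if c₀ a = c₀ b then 0 else t)) := by
  classical
  rw [← nsmul_eq_mul, ← Finset.sum_const]
  refine Finset.sum_congr rfl fun c hc => ?_
  rw [Finset.mem_filter] at hc
  rw [hc.2 a ha, hc.2 b hb]

/-! ## The conditional expectation, matrix form -/

/-- **Conditional expectations of the bichromatic mass are non-negative (matrix form).** For `V` symmetric with zero
diagonal and `k`-clique-non-negative (`4 ≤ k`), `2 ≤ q`, a vertex set `H` with `k ≤ #Hᶜ` and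
`(k−2)·#H/(#Hᶜ−1) ≤ 1/2`, and any colouring `c₀`:
`0 ≤ ∑_{c : c|_H = c₀|_H} ∑_{a,b} 𝟙[c a ≠ c b]·V a b`. [new] -/
theorem sum_extensions_bichMass_nonneg {k : ℕ} (hq : 2 ≤ q) (V : Fin m → Fin m → ℝ) (hV : ∀ x y, V x y = V y x)
    (hV0 : ∀ x, V x x = 0) (hk : 4 ≤ k)
    (hvalid : ∀ Q ∈ (Finset.univ : Finset (Fin m)).powersetCard k, 0 ≤ ∑ x ∈ Q, ∑ y ∈ Q, V x y)
    (H : Finset (Fin m)) (hS : k ≤ (Hᶜ).card) (hX : ((k : ℝ) - 2) * H.card / (((Hᶜ).card : ℝ) - 1) ≤ 1 / 2)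
    (c₀ : Fin m → Fin q) :
    0 ≤ ∑ c ∈ (Finset.univ : Finset (Fin m → Fin q)).filter (fun c => ∀ x ∈ H, c x = c₀ x),
      ∑ a, ∑ b, (if c a = c b then 0 else V a b) := by
  classical
  have hqpos : 0 < q := by omega
  have hqR : (2 : ℝ) ≤ q := by exact_mod_cast hq
  have hqR0 : (0 : ℝ) < q := by linarith
  set ext := (Finset.univ : Finset (Fin m → Fin q)).filter (fun c => ∀ x ∈ H, c x = c₀ x) with hext
  set N : ℝ := (ext.card : ℝ) with hN
  have hN0 : 0 ≤ N := Nat.cast_nonneg _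
  -- the pairwise counts
  have hpair : ∀ a b : Fin m, ∑ c ∈ ext, (if c a = c b then 0 else V a b) =
      if a ∈ H ∧ b ∈ H then N * (if c₀ a = c₀ b then 0 else V a b) else (((q : ℝ) - 1) / q) * (N * V a b) := by
    intro a b
    by_cases hab : a = b
    · subst hab
      simp only [hV0, if_true]
      rw [Finset.sum_const_zero]
      split_ifs <;> simp
    by_cases h : a ∈ H ∧ b ∈ H
    · rw [if_pos h, hN, hext]
      exact sum_extensions_ite_mem H c₀ h.1 h.2 (V a b)
    · rw [if_neg h]
      rcases not_and_or.1 h with ha | hb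
      · rw [hN, hext]; exact sum_extensions_ite_ne hqpos H c₀ ha hab (V a b)
      · have hsym : ∑ c ∈ ext, (if c a = c b then (0 : ℝ) else V a b) = ∑ c ∈ ext, (if c b = c a then 0 else V b a) :=
          Finset.sum_congr rfl fun c _ => by rw [hV a b]; simp only [eq_comm]
        rw [hsym, hN, hext, hV a b]
        exact sum_extensions_ite_ne hqpos H c₀ hb (Ne.symm hab) (V b a)
  -- swap the sums
  rw [Finset.sum_comm]
  have hswap : ∀ a : Fin m, ∑ c ∈ ext, ∑ b, (if c a = c b then (0 : ℝ) else V a b) =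
      ∑ b, ∑ c ∈ ext, (if c a = c b then (0 : ℝ) else V a b) := fun a => Finset.sum_comm
  simp_rw [hswap, hpair]
  -- evaluate: `N · (bich_H(c₀) + ((q-1)/q) · (∑∑ V − ∑_{H×H} V))`
  have hsplit : ∀ a : Fin m, ∑ b, (if a ∈ H ∧ b ∈ H then N * (if c₀ a = c₀ b then 0 else V a b)
      else ((q : ℝ) - 1) / q * (N * V a b)) =
      ∑ b, (((q : ℝ) - 1) / q * (N * V a b)) +
        ∑ b, (if a ∈ H ∧ b ∈ H then N * (if c₀ a = c₀ b then 0 else V a b) - ((q : ℝ) - 1) / q * (N * V a b) else 0) := by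
    intro a
    rw [← Finset.sum_add_distrib]
    refine Finset.sum_congr rfl fun b _ => ?_
    split_ifs <;> ring
  simp_rw [hsplit]
  rw [Finset.sum_add_distrib, sum_sum_ite_mem_and H]
  -- the correction inside `H` is bounded below by `-N·negH - ((q-1)/q)·N·massH·2`-type terms; use the realisation lemma
  have hneg := negMass_hub_le V hV hV0 hk hvalid H hS hX
  have hmassOut := massOut_nonneg V hV hV0 hk hvalid H hS (hX.trans (by norm_num))
  have hX0 : 0 ≤ ((k : ℝ) - 2) * H.card / (((Hᶜ).card : ℝ) - 1) := by
    have hkR : (4 : ℝ) ≤ k := by exact_mod_cast hk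
    have hs1R : (1 : ℝ) < (Hᶜ).card := by exact_mod_cast (show 1 < (Hᶜ).card by omega)
    exact div_nonneg (mul_nonneg (by linarith) (Nat.cast_nonneg _)) (by linarith)
  -- pointwise: `N·𝟙[c₀ a ≠ c₀ b] V a b - ((q-1)/q) N V a b ≥ -N·max(-V a b, 0) - ((q-1)/q)·N·V a b`
  have hpt : ∀ a ∈ H, ∀ b ∈ H, -(N * max (-V a b) 0) - ((q : ℝ) - 1) / q * (N * V a b) ≤
      N * (if c₀ a = c₀ b then 0 else V a b) - ((q : ℝ) - 1) / q * (N * V a b) := by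
    intro a _ b _
    have h1 : -(N * max (-V a b) 0) ≤ N * (if c₀ a = c₀ b then 0 else V a b) := by
      rw [← mul_neg]
      refine mul_le_mul_of_nonneg_left ?_ hN0
      split_ifs
      · exact neg_nonpos.2 (le_max_right _ _)
      · have := le_max_left (-V a b) 0; linarith
    linarith
  have hsumH : -(N * ∑ a ∈ H, ∑ b ∈ H, max (-V a b) 0) - ((q : ℝ) - 1) / q * (N * ∑ a ∈ H, ∑ b ∈ H, V a b) ≤
      ∑ a ∈ H, ∑ b ∈ H, (N * (if c₀ a = c₀ b then 0 else V a b) - ((q : ℝ) - 1) / q * (N * V a b)) := by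
    have := Finset.sum_le_sum fun a ha => Finset.sum_le_sum fun b hb => hpt a ha b hb
    refine le_trans (le_of_eq ?_) this
    simp only [Finset.sum_sub_distrib, Finset.sum_neg_distrib, Finset.mul_sum]
  have htot : ∑ a, ∑ b, ((q : ℝ) - 1) / q * (N * V a b) = ((q : ℝ) - 1) / q * (N * ∑ a, ∑ b, V a b) := by
    simp only [Finset.mul_sum]
  rw [htot]
  -- combine: total ≥ ((q-1)/q)·N·(∑∑V − ∑_{H×H}V) − N·∑_{H×H} max(-V,0) = N·(2(q-1)/q·massOut − 2 negH) ≥ 0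
  have hq1 : 0 ≤ ((q : ℝ) - 1) / q := div_nonneg (by linarith) hqR0.le
  have hhalf : (1 : ℝ) / 2 ≤ ((q : ℝ) - 1) / q := by
    rw [div_le_div_iff₀ (by norm_num) hqR0]; linarith
  have hkey : 0 ≤ ((q : ℝ) - 1) / q * (N * ∑ a, ∑ b, V a b) +
      (-(N * ∑ a ∈ H, ∑ b ∈ H, max (-V a b) 0) - ((q : ℝ) - 1) / q * (N * ∑ a ∈ H, ∑ b ∈ H, V a b)) := by
    -- `negH ≤ X·massOut ≤ ½ massOut ≤ ((q-1)/q) massOut`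
    have h1 : (∑ a ∈ H, ∑ b ∈ H, max (-V a b) 0) / 2 ≤
        ((q : ℝ) - 1) / q * ((∑ x, ∑ y, V x y) / 2 - (∑ a ∈ H, ∑ b ∈ H, V a b) / 2) :=
      hneg.trans ((mul_le_mul_of_nonneg_right hX hmassOut).trans (mul_le_mul_of_nonneg_right hhalf hmassOut))
    have h2 := mul_le_mul_of_nonneg_left h1 hN0
    nlinarith [h2]
  linarith [hsumH]

/-! ## Edge form -/

/-- **`E[w(bich_c) | c|_H] ≥ 0` (edge form).** For a `k`-clique-non-negative edge weighting `w` of `K_m` (`4 ≤ k`), `2 ≤ q`,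
a vertex set `H` with `k ≤ #Hᶜ` and `(k−2)·#H/(#Hᶜ−1) ≤ 1/2`, and any colouring `c₀ : Fin m → Fin q`: the total `w`-weight
of the complete multipartite graphs `colorVec c`, summed over all colourings `c` agreeing with `c₀` on `H`, is
non-negative. [new] -/
theorem sum_extensions_colorVec_nonneg {k : ℕ} (hq : 2 ≤ q) (hk : 4 ≤ k) (w : Edge m → ℝ)
    (hw : ∀ Q ∈ (Finset.univ : Finset (Fin m)).powersetCard k, 0 ≤ softWindow w Q)
    (H : Finset (Fin m)) (hS : k ≤ (Hᶜ).card) (hX : ((k : ℝ) - 2) * H.card / (((Hᶜ).card : ℝ) - 1) ≤ 1 / 2)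
    (c₀ : Fin m → Fin q) :
    0 ≤ ∑ c ∈ (Finset.univ : Finset (Fin m → Fin q)).filter (fun c => ∀ x ∈ H, c x = c₀ x),
      ∑ e, (if colorVec c e = true then w e else 0) := by
  classical
  -- the symmetric matrix of `w`
  obtain ⟨V, hVdef⟩ : ∃ V : Fin m → Fin m → ℝ,
      V = fun x y => if h : x = y then 0 else w ⟨s(x, y), CliqueExtLowerBound.Negative.mk_mem_edgeSet_top h⟩ := ⟨_, rfl⟩
  have hV0 : ∀ x, V x x = 0 := fun x => by rw [hVdef]; simp
  have hVoff : ∀ (x y : Fin m) (h : x ≠ y), V x y = w ⟨s(x, y), CliqueExtLowerBound.Negative.mk_mem_edgeSet_top h⟩ :=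
    fun x y h => by rw [hVdef]; simp [h]
  have hVsym : ∀ x y, V x y = V y x := by
    intro x y
    by_cases h : x = y
    · rw [h]
    · rw [hVoff x y h, hVoff y x (Ne.symm h)]
      congr 1
      exact Subtype.ext Sym2.eq_swap
  have hvalidM : ∀ Q ∈ (Finset.univ : Finset (Fin m)).powersetCard k, 0 ≤ ∑ x ∈ Q, ∑ y ∈ Q, V x y := by
    intro Q hQ
    have h := hw Q hQ
    rw [softWindow_eq_half_sum_sum w V hV0 hVoff Q] at h
    linarith
  have hbich : ∀ c : Fin m → Fin q, ∑ e, (if colorVec c e = true then w e else 0) =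
      (∑ x, ∑ y, if c x = c y then 0 else V x y) / 2 := by
    intro c
    refine sum_edge_eq_half_sum_sum _ _ (fun x => by rw [if_pos rfl]) (fun x y h => ?_)
    by_cases hc : c x = c y
    · rw [if_pos hc, if_neg]
      rw [(colorVec_mk_eq_false_iff c _).2 hc]
      exact Bool.false_ne_true
    · rw [if_neg hc, hVoff x y h, if_pos]
      cases hcv : colorVec c ⟨s(x, y), CliqueExtLowerBound.Negative.mk_mem_edgeSet_top h⟩
      · exact absurd ((colorVec_mk_eq_false_iff c _).1 hcv) hc
      · rfl
  simp_rw [hbich]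
  rw [← Finset.sum_div]
  exact div_nonneg (sum_extensions_bichMass_nonneg hq V hVsym hV0 hk hvalidM H hS hX c₀) (by norm_num)

/-- **`E[w(bich_c) | c|_H] ≥ 0`** (registered form of `sum_extensions_colorVec_nonneg`). [new] -/
theorem conditional_bichMass_nonneg : ∀ {m q k : ℕ}, 2 ≤ q → 4 ≤ k → ∀ (w : Edge m → ℝ), (∀ Q ∈ (Finset.univ : Finset (Fin m)).powersetCard k, 0 ≤ softWindow w Q) → ∀ (H : Finset (Fin m)), k ≤ (Hᶜ).card → ((k : ℝ) - 2) * H.card / (((Hᶜ).card : ℝ) - 1) ≤ 1 / 2 → ∀ (c₀ : Fin m → Fin q), 0 ≤ ∑ c ∈ (Finset.univ : Finset (Fin m → Fin q)).filter (fun c => ∀ x ∈ H, c x = c₀ x), ∑ e, (if colorVec c e = true then w e else 0) :=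
  fun hq hk w hw H hS hX c₀ => sum_extensions_colorVec_nonneg hq hk w hw H hS hX c₀

end

end Summit.PneNP.PneNP.Theorems
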